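import Literature.NumberTheory.EllipticCurves.ShaPTorsionQuadraticSplitting
import Literature.NumberTheory.EllipticCurves.SecondDescentShaExponentProofs
import Literature.NumberTheory.EllipticCurves.Greenberg1999.TwoTorsionMuInvariant
import Mathlib.Algebra.Polynomial.SpecificDegree
import HarnessLib

/-!
# The `p`-descent counts the `p`-torsion of the `p^∞`-Selmer group — `#Sel^(p)(E/F) = #E(F)[p] · #Sel_{p^∞}(E/F)[p]` —
# and a curve without a rational point of order `2` acquires none in an extension of degree prime to `3`

Topic `NumberTheory/EllipticCurves`; THEOREMS ONLY (no definition, no named fact, no instance, no `sorry`).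
Two bookkeeping facts that translate statements about the `p`-torsion `Sel_{p^∞}(E/F)[p]` of the `p^∞`-Selmer group
(the currency of Iwasawa theory: Greenberg LNM 1716 §§1–3, the tree's `selmerGroupPInfty`, `selmerLayer`) into the
currency of an honest `p`-DESCENT (`Sel^(p)(E/F) ⊆ H¹(F, E[p])`, the tree's `selmerGroup W p`, Silverman X.4.2 — what
`mwrank` / `TwoSelmerGroup` compute):

* §1 (any number field `F`, any prime `p`): `#Sel^(p)(E/F) = #E(F)[p] · #Sel_{p^∞}(E/F)[p]`
  (`natCard_selmerGroup_eq_natCard_torsionBy_point_mul`): both sides equal `p^{rank E(F)} · #E(F)[p] · #Ш(E/F)[p]`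
  (tree: `pow_mordellWeilRank_mul_natCard_torsionBy_mul_natCard_shaTorsionBy_eq` = Silverman X.4.2, and
  `natCard_torsionBy_selmerGroupPInfty_eq` = Greenberg §2's fundamental sequence counted on `p`-torsion). Hence
  `#Sel_{p^∞}[p] ≤ #Sel^(p)`, with equality iff `E(F)[p] = 0`.
* §2 (any field `K` with `2 ≠ 0`, any extension `L/K`): a point of order `2` of `E_L` has abscissa a root of the
  `2`-division cubic `4x³ + b₂x² + 2b₄x + b₆` (`WeierstrassCurve.twoTorsionPolynomial`, Silverman III.§2:
  `ψ₂² = 4x³ + b₂x² + 2b₄x + b₆` with `ψ₂ = 2y + a₁x + a₃`); if that cubic has no root in `K` it is irreducible, so a root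
  generates a cubic subextension and **`E(L)[2] = 0` whenever `3 ∤ [L : K]`**
  (`forall_two_smul_eq_zero_baseChange_of_not_three_dvd_finrank`). Over `ℚ` the root-freeness is the binder
  «`∀ x, ¬ HasRationalTwoTorsionX W x`» of the tree (`hasRationalTwoTorsionX_iff_isRoot_twoTorsionPolynomial`), and the
  conclusion holds in every extension of `2`-power degree — every layer `ℚ_n` of the cyclotomic `ℤ₂`-extension.

Not here: anything about `p`-torsion for odd `p` in `p`-extensions (a different, Galois-theoretic argument), the Cassels
pairing, or any Selmer group over an infinite extension.

References: J. H. Silverman, *The Arithmetic of Elliptic Curves*, GTM 106 (2nd ed. 2009), III.§2 (the `2`-division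
polynomial), VIII.6.7, X.4.2 [SilvermanAEC2009]; R. Greenberg, LNM 1716 (1999), §2 pp. 62–63 [Greenberg1999LNM].
-/

noncomputable section

open scoped Classical AddSubgroup Polynomial IntermediateField

universe u v

namespace WeierstrassCurve

open Literature.NumberTheory.EllipticCurves Polynomial

/-! ## §1 `#Sel^(p)(E/F) = #E(F)[p] · #Sel_{p^∞}(E/F)[p]` -/

section DescentCount

variable {F : Type u} [Field F] [NumberField F] (X : WeierstrassCurve F) [X.IsElliptic] (p : ℕ) [hp : Fact p.Prime]

/-- **`#Sel^(p)(E/F) = #E(F)[p] · #Sel_{p^∞}(E/F)[p]`** for an elliptic curve `E` over a number field `F` and a prime `p`: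
the `p`-Selmer group of a `p`-descent (`X.selmerGroup p ⊆ H¹(F, E[p])`) and the `p`-torsion of the `p^∞`-Selmer group
(`X.selmerGroupPInfty p ⊆ H¹(F, E[p^∞])`) differ exactly by the rational `p`-torsion: both equal
`p^{rank E(F)} · #Ш(E/F)[p]` times `#E(F)[p]`, resp. times `1` (Silverman X.4.2; Greenberg §2's sequence
`0 → E(F) ⊗ ℚ_p/ℤ_p → Sel_{p^∞} → Ш[p^∞] → 0` read on `p`-torsion). Deliberate dot-notation extension of Mathlib's
`WeierstrassCurve` namespace. [cite: SilvermanAEC2009, Thm. X.4.2] [cite: Greenberg1999LNM, §2 pp. 62–63] -/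
theorem natCard_selmerGroup_eq_natCard_torsionBy_point_mul :
    Nat.card (X.selmerGroup p) =
      Nat.card (X.toAffine.Point[(p : ℤ)]) * Nat.card ((X.selmerGroupPInfty p)[(p : ℤ)]) := by
  rw [X.natCard_torsionBy_selmerGroupPInfty_eq p,
    ← X.pow_mordellWeilRank_mul_natCard_torsionBy_mul_natCard_shaTorsionBy_eq hp.out.ne_zero]
  ring

/-- **`#Sel_{p^∞}(E/F)[p] ≤ #Sel^(p)(E/F)`**: the Kummer lift `Sel^(p) ↠ Sel_{p^∞}[p]` is onto; in numbers, §1's identity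
with `#E(F)[p] ≥ 1`. [cite: SilvermanAEC2009, Thm. X.4.2] [cite: Greenberg1999LNM, §2 pp. 62–63] -/
theorem natCard_torsionBy_selmerGroupPInfty_le_natCard_selmerGroup :
    Nat.card ((X.selmerGroupPInfty p)[(p : ℤ)]) ≤ Nat.card (X.selmerGroup p) := by
  rw [X.natCard_selmerGroup_eq_natCard_torsionBy_point_mul p]
  exact Nat.le_mul_of_pos_left _ (Nat.pos_of_ne_zero (X.natCard_torsionBy_point_ne_zero hp.out.ne_zero))

/-- **`E(F)[p] = 0` ⟹ `#Sel^(p)(E/F) = #Sel_{p^∞}(E/F)[p]`**: without rational `p`-torsion the `p`-descent computes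
exactly the `p`-torsion of the `p^∞`-Selmer group (hypothesis in the shape `p • P = 0 → P = 0`).
[cite: SilvermanAEC2009, Thm. X.4.2] [cite: Greenberg1999LNM, §2 pp. 62–63] -/
theorem natCard_selmerGroup_eq_natCard_torsionBy_selmerGroupPInfty_of_forall
    (ht : ∀ P : X.toAffine.Point, (p : ℤ) • P = 0 → P = 0) :
    Nat.card (X.selmerGroup p) = Nat.card ((X.selmerGroupPInfty p)[(p : ℤ)]) := by
  have h1 : Nat.card (X.toAffine.Point[(p : ℤ)]) = 1 := by
    haveI : Subsingleton (X.toAffine.Point[(p : ℤ)]) := ⟨fun a b ↦ Subtype.ext <| by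
      rw [ht a.1 ((Submodule.mem_torsionBy_iff _ _).mp a.2), ht b.1 ((Submodule.mem_torsionBy_iff _ _).mp b.2)]⟩
    exact Nat.card_of_subsingleton (0 : X.toAffine.Point[(p : ℤ)])
  rw [X.natCard_selmerGroup_eq_natCard_torsionBy_point_mul p, h1, one_mul]

/-- **`E(F)[p] = ⊥` ⟹ `#Sel^(p)(E/F) = #Sel_{p^∞}(E/F)[p]`** (subgroup form of the previous statement).
[cite: SilvermanAEC2009, Thm. X.4.2] [cite: Greenberg1999LNM, §2 pp. 62–63] -/
theorem natCard_selmerGroup_eq_natCard_torsionBy_selmerGroupPInfty_of_torsionBy_eq_bot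
    (ht : X.toAffine.Point[(p : ℤ)] = ⊥) :
    Nat.card (X.selmerGroup p) = Nat.card ((X.selmerGroupPInfty p)[(p : ℤ)]) := by
  rw [X.natCard_selmerGroup_eq_natCard_torsionBy_point_mul p, ht, AddSubgroup.card_bot, one_mul]

end DescentCount

/-! ## §2 Points of order `2` under base change of degree prime to `3` -/

section TwoTorsionBaseChange

variable {K : Type u} [Field K] (W : WeierstrassCurve K) {L : Type v} [Field L] [Algebra K L]

/-- The `2`-division cubic evaluated at `x ∈ L`: `Ψ₂(x) = 4x³ + b₂x² + 2b₄x + b₆` with the `bᵢ` of `W` mapped to `L`.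
[cite: SilvermanAEC2009, §III.2 (ψ₂² = 4x³ + b₂x² + 2b₄x + b₆)] -/
theorem aeval_twoTorsionPolynomial (x : L) :
    aeval x W.twoTorsionPolynomial.toPoly =
      4 * x ^ 3 + algebraMap K L W.b₂ * x ^ 2 + 2 * algebraMap K L W.b₄ * x + algebraMap K L W.b₆ := by
  simp only [WeierstrassCurve.twoTorsionPolynomial, Cubic.toPoly, map_add, map_mul, aeval_C, aeval_X_pow, aeval_X,
    map_ofNat]

/-- The `2`-division cubic evaluated at `x ∈ K`: `Ψ₂(x) = 4x³ + b₂x² + 2b₄x + b₆`.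
[cite: SilvermanAEC2009, §III.2 (ψ₂² = 4x³ + b₂x² + 2b₄x + b₆)] -/
theorem eval_twoTorsionPolynomial_toPoly (x : K) :
    W.twoTorsionPolynomial.toPoly.eval x = 4 * x ^ 3 + W.b₂ * x ^ 2 + 2 * W.b₄ * x + W.b₆ := by
  have h := W.aeval_twoTorsionPolynomial (L := K) x
  simpa using h

/-- **A point of order dividing `2` on `E_L` is `O` or has `2y + a₁x + a₃ = 0` and abscissa a root of the `2`-division
cubic**: for an affine point `(x, y)` of the base change `E_L` with `2·(x, y) = O`, i.e. `(x, y) = −(x, y) =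
(x, −y − a₁x − a₃)`, one has `ψ₂(x, y) = 2y + a₁x + a₃ = 0` and `Ψ₂(x) = ψ₂² = 0`.
[cite: SilvermanAEC2009, §III.2 (Group Law III.2.3 and ψ₂)] -/
theorem aeval_twoTorsionPolynomial_eq_zero_of_two_smul_eq_zero {x y : L}
    (h : (W.baseChange L).toAffine.Nonsingular x y)
    (h2 : (2 : ℤ) • (Affine.Point.some x y h : (W.baseChange L).toAffine.Point) = 0) :
    2 * y + algebraMap K L W.a₁ * x + algebraMap K L W.a₃ = 0 ∧ aeval x W.twoTorsionPolynomial.toPoly = 0 := by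
  have hA1 : (W.baseChange L).toAffine.a₁ = algebraMap K L W.a₁ := rfl
  have hA2 : (W.baseChange L).toAffine.a₂ = algebraMap K L W.a₂ := rfl
  have hA3 : (W.baseChange L).toAffine.a₃ = algebraMap K L W.a₃ := rfl
  have hA4 : (W.baseChange L).toAffine.a₄ = algebraMap K L W.a₄ := rfl
  have hA6 : (W.baseChange L).toAffine.a₆ = algebraMap K L W.a₆ := rfl
  -- `P = -P`
  have hneg : (Affine.Point.some x y h : (W.baseChange L).toAffine.Point) = -Affine.Point.some x y h :=
    eq_neg_of_add_eq_zero_left (by rwa [two_zsmul] at h2)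
  rw [Affine.Point.neg_some, Affine.Point.some.injEq] at hneg
  have hy : y = -y - (W.baseChange L).toAffine.a₁ * x - (W.baseChange L).toAffine.a₃ := hneg.2
  rw [hA1, hA3] at hy
  have he : 2 * y + algebraMap K L W.a₁ * x + algebraMap K L W.a₃ = 0 := by linear_combination hy
  refine ⟨he, ?_⟩
  have heq := (Affine.equation_iff x y).mp h.1
  rw [hA1, hA2, hA3, hA4, hA6] at heq
  rw [W.aeval_twoTorsionPolynomial x]
  simp only [WeierstrassCurve.b₂, WeierstrassCurve.b₄, WeierstrassCurve.b₆, map_add, map_mul, map_pow, map_ofNat]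
  linear_combination (2 * y + algebraMap K L W.a₁ * x + algebraMap K L W.a₃) * he - 4 * heq

/-- **A `K`-root of the `2`-division cubic is the abscissa of a `K`-point of order `2`** (for `2 ≠ 0` in `K`): with
`y₀ = −(a₁x₀ + a₃)/2` the pair `(x₀, y₀)` satisfies the Weierstrass equation and `2y₀ + a₁x₀ + a₃ = 0`.
[cite: SilvermanAEC2009, §III.2 (ψ₂² = 4x³ + b₂x² + 2b₄x + b₆)] -/
theorem exists_equation_of_isRoot_twoTorsionPolynomial (h2 : (2 : K) ≠ 0) {x₀ : K}
    (hx : W.twoTorsionPolynomial.toPoly.IsRoot x₀) :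
    ∃ y₀ : K, W.toAffine.Equation x₀ y₀ ∧ 2 * y₀ + W.a₁ * x₀ + W.a₃ = 0 := by
  refine ⟨-(W.a₁ * x₀ + W.a₃) / 2, ?_, by field_simp; ring⟩
  have hΨ : 4 * x₀ ^ 3 + W.b₂ * x₀ ^ 2 + 2 * W.b₄ * x₀ + W.b₆ = 0 := by
    rw [← W.eval_twoTorsionPolynomial_toPoly x₀]
    exact hx
  set y₀ : K := -(W.a₁ * x₀ + W.a₃) / 2 with hy₀
  have he : 2 * y₀ + W.a₁ * x₀ + W.a₃ = 0 := by rw [hy₀]; field_simp; ring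
  rw [Affine.equation_iff]
  have hA1 : W.toAffine.a₁ = W.a₁ := rfl
  have hA2 : W.toAffine.a₂ = W.a₂ := rfl
  have hA3 : W.toAffine.a₃ = W.a₃ := rfl
  have hA4 : W.toAffine.a₄ = W.a₄ := rfl
  have hA6 : W.toAffine.a₆ = W.a₆ := rfl
  rw [hA1, hA2, hA3, hA4, hA6]
  have h4 : (4 : K) ≠ 0 := by
    have : (4 : K) = 2 * 2 := by norm_num
    rw [this]; exact mul_ne_zero h2 h2
  -- `4 · (lhs − rhs) = ψ₂² − Ψ₂(x₀) = 0`
  have hmul : (4 : K) * (y₀ ^ 2 + W.a₁ * x₀ * y₀ + W.a₃ * y₀ - (x₀ ^ 3 + W.a₂ * x₀ ^ 2 + W.a₄ * x₀ + W.a₆)) = 0 := by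
    simp only [WeierstrassCurve.b₂, WeierstrassCurve.b₄, WeierstrassCurve.b₆] at hΨ
    linear_combination (2 * y₀ + W.a₁ * x₀ + W.a₃) * he - hΨ
  rcases mul_eq_zero.mp hmul with h | h
  · exact absurd h h4
  · exact sub_eq_zero.mp h

/-- **The `2`-division cubic of a curve without a `K`-point of order `2` is irreducible over `K`** (`2 ≠ 0` in `K`): it
has degree `3` (leading coefficient `4 ≠ 0`) and no root in `K`. [cite: SilvermanAEC2009, §III.2 (ψ₂)] -/
theorem irreducible_twoTorsionPolynomial_of_forall_not_isRoot (h2 : (2 : K) ≠ 0)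
    (hK : ∀ x : K, ¬ W.twoTorsionPolynomial.toPoly.IsRoot x) : Irreducible W.twoTorsionPolynomial.toPoly := by
  have h4 : (4 : K) ≠ 0 := by
    have : (4 : K) = 2 * 2 := by norm_num
    rw [this]; exact mul_ne_zero h2 h2
  have hdeg : W.twoTorsionPolynomial.toPoly.natDegree = 3 := Cubic.natDegree_of_a_ne_zero h4
  exact irreducible_of_degree_le_three_of_not_isRoot (by rw [hdeg]; decide) hK

/-- **An irreducible cubic over `K` has no root in an extension `L/K` with `3 ∤ [L : K]`**: a root `x ∈ L` would
generate `K(x)` with `[K(x) : K] = 3` dividing `[L : K]` (tower law). Pure field theory.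
[cite: SilvermanAEC2009, §III.2 (applied to ψ₂; the degree count is the standard tower law)] -/
theorem aeval_ne_zero_of_irreducible_of_natDegree_eq_three_of_not_three_dvd_finrank [FiniteDimensional K L]
    {Ψ : K[X]} (hirr : Irreducible Ψ) (hdeg : Ψ.natDegree = 3) (h3 : ¬ 3 ∣ Module.finrank K L) (x : L) :
    aeval x Ψ ≠ 0 := by
  intro hx
  have hΨ0 : Ψ ≠ 0 := hirr.ne_zero
  have hlc : Ψ.leadingCoeff ≠ 0 := leadingCoeff_ne_zero.mpr hΨ0
  -- the monic associate of `Ψ` is the minimal polynomial of `x`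
  set Ψm : K[X] := Ψ * C Ψ.leadingCoeff⁻¹ with hΨm
  have hmonic : Ψm.Monic := monic_mul_leadingCoeff_inv hΨ0
  have hirrm : Irreducible Ψm := (irreducible_mul_isUnit (isUnit_C.mpr (IsUnit.inv (Ne.isUnit hlc)))).mpr hirr
  have haev : aeval x Ψm = 0 := by rw [hΨm, map_mul, hx, zero_mul]
  have hmin : Ψm = minpoly K x := minpoly.eq_of_irreducible_of_monic hirrm haev hmonic
  have hdegm : (minpoly K x).natDegree = 3 := by
    rw [← hmin, hΨm, natDegree_mul_leadingCoeff_inv _ hΨ0, hdeg]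
  have hint : _root_.IsIntegral K x := Algebra.IsIntegral.isIntegral x
  have hfin : Module.finrank K K⟮x⟯ = 3 := by rw [IntermediateField.adjoin.finrank hint, hdegm]
  have htower := Module.finrank_mul_finrank K K⟮x⟯ L
  rw [hfin] at htower
  exact h3 ⟨Module.finrank (↥K⟮x⟯) L, htower.symm⟩

/-- ★ **No point of order `2` over `K` ⟹ none over any `L/K` with `3 ∤ [L : K]`.** For a Weierstrass curve `W/K`
(`2 ≠ 0` in `K`) whose `2`-division cubic `4x³ + b₂x² + 2b₄x + b₆` has no root in `K`, and a finite extension `L/K` of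
degree prime to `3`: every `L`-point `P` of the base change `E_L` with `2P = O` is `O`. (The cubic is irreducible over
`K`; the abscissa of a point of order `2` over `L` would be a root generating a cubic subextension of `L`.)
[cite: SilvermanAEC2009, §III.2 (ψ₂² = 4x³ + b₂x² + 2b₄x + b₆)] -/
theorem forall_two_smul_eq_zero_baseChange_of_not_three_dvd_finrank [FiniteDimensional K L] (h2 : (2 : K) ≠ 0)
    (hK : ∀ x : K, ¬ W.twoTorsionPolynomial.toPoly.IsRoot x) (h3 : ¬ 3 ∣ Module.finrank K L) :
    ∀ P : (W.baseChange L).toAffine.Point, (2 : ℤ) • P = 0 → P = 0 := by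
  have hirr := W.irreducible_twoTorsionPolynomial_of_forall_not_isRoot h2 hK
  have h4 : (4 : K) ≠ 0 := by
    have : (4 : K) = 2 * 2 := by norm_num
    rw [this]; exact mul_ne_zero h2 h2
  have hdeg : W.twoTorsionPolynomial.toPoly.natDegree = 3 := Cubic.natDegree_of_a_ne_zero h4
  rintro (_ | ⟨x, y, h⟩) hP
  · rfl
  · exact absurd (W.aeval_twoTorsionPolynomial_eq_zero_of_two_smul_eq_zero h hP).2
      (aeval_ne_zero_of_irreducible_of_natDegree_eq_three_of_not_three_dvd_finrank hirr hdeg h3 _)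

/-- Subgroup form: `E(L)[2] = ⊥` under the hypotheses of
`forall_two_smul_eq_zero_baseChange_of_not_three_dvd_finrank`. [cite: SilvermanAEC2009, §III.2 (ψ₂)] -/
theorem torsionBy_two_baseChange_eq_bot_of_not_three_dvd_finrank [FiniteDimensional K L] (h2 : (2 : K) ≠ 0)
    (hK : ∀ x : K, ¬ W.twoTorsionPolynomial.toPoly.IsRoot x) (h3 : ¬ 3 ∣ Module.finrank K L) :
    (W.baseChange L).toAffine.Point[(2 : ℤ)] = ⊥ := by
  refine eq_bot_iff.mpr fun P hP ↦ (AddSubgroup.mem_bot).mpr ?_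
  exact W.forall_two_smul_eq_zero_baseChange_of_not_three_dvd_finrank h2 hK h3 P
    ((Submodule.mem_torsionBy_iff _ _).mp hP)

/-- Cardinality form: `#E(L)[2] = 1` under the hypotheses of
`forall_two_smul_eq_zero_baseChange_of_not_three_dvd_finrank`. [cite: SilvermanAEC2009, §III.2 (ψ₂)] -/
theorem natCard_torsionBy_two_baseChange_eq_one_of_not_three_dvd_finrank [FiniteDimensional K L]
    (h2 : (2 : K) ≠ 0) (hK : ∀ x : K, ¬ W.twoTorsionPolynomial.toPoly.IsRoot x)
    (h3 : ¬ 3 ∣ Module.finrank K L) :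
    Nat.card ((W.baseChange L).toAffine.Point[(2 : ℤ)]) = 1 := by
  rw [W.torsionBy_two_baseChange_eq_bot_of_not_three_dvd_finrank h2 hK h3, AddSubgroup.card_bot]

end TwoTorsionBaseChange

/-! ## §3 Over `ℚ`: the binder «no rational `2`-torsion abscissa» and extensions of `2`-power degree -/

section Rat

open Literature.NumberTheory.EllipticCurves.Greenberg1999

variable (W : WeierstrassCurve ℚ) {L : Type v} [Field L] [Algebra ℚ L]

/-- **`HasRationalTwoTorsionX W x` ⟺ `x` is a rational root of the `2`-division cubic `4x³ + b₂x² + 2b₄x + b₆`**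
(the tree's binder, Greenberg LNM 1716 Prop. 5.14 «`E(ℚ)` contains an element of order `2` with `x(P) = x`», read
through `ψ₂² = 4x³ + b₂x² + 2b₄x + b₆`). [cite: SilvermanAEC2009, §III.2 (ψ₂)] -/
theorem hasRationalTwoTorsionX_iff_isRoot_twoTorsionPolynomial (x : ℚ) :
    HasRationalTwoTorsionX W x ↔ W.twoTorsionPolynomial.toPoly.IsRoot x := by
  constructor
  · rintro ⟨y, heq, he⟩
    have heq' := (Affine.equation_iff x y).mp heq
    have hA1 : W.toAffine.a₁ = W.a₁ := rfl
    have hA2 : W.toAffine.a₂ = W.a₂ := rfl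
    have hA3 : W.toAffine.a₃ = W.a₃ := rfl
    have hA4 : W.toAffine.a₄ = W.a₄ := rfl
    have hA6 : W.toAffine.a₆ = W.a₆ := rfl
    rw [hA1, hA2, hA3, hA4, hA6] at heq'
    change W.twoTorsionPolynomial.toPoly.eval x = 0
    rw [W.eval_twoTorsionPolynomial_toPoly x]
    simp only [WeierstrassCurve.b₂, WeierstrassCurve.b₄, WeierstrassCurve.b₆]
    linear_combination (2 * y + W.a₁ * x + W.a₃) * he - 4 * heq'
  · intro hx
    exact W.exists_equation_of_isRoot_twoTorsionPolynomial two_ne_zero hx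

/-- ★ **No rational `2`-torsion abscissa ⟹ `E(L)[2] = 0` for every finite extension `L/ℚ` with `3 ∤ [L : ℚ]`** (in the
shape `2 • P = 0 → P = 0` on the Mordell–Weil group of the base change `E_L`). In particular for every `L` of `2`-power
degree: the layers `ℚ_n = ℚ(ζ_{2^{n+2}})⁺` of the cyclotomic `ℤ₂`-extension, `ℚ(√d)`, `ℚ(E[2])`-free towers.
[cite: SilvermanAEC2009, §III.2 (ψ₂² = 4x³ + b₂x² + 2b₄x + b₆)] -/
theorem forall_two_smul_eq_zero_baseChange_of_forall_not_hasRationalTwoTorsionX [FiniteDimensional ℚ L]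
    (ht : ∀ x : ℚ, ¬ HasRationalTwoTorsionX W x) (h3 : ¬ 3 ∣ Module.finrank ℚ L) :
    ∀ P : (W.baseChange L).toAffine.Point, (2 : ℤ) • P = 0 → P = 0 :=
  W.forall_two_smul_eq_zero_baseChange_of_not_three_dvd_finrank two_ne_zero
    (fun x hx ↦ ht x ((W.hasRationalTwoTorsionX_iff_isRoot_twoTorsionPolynomial x).mpr hx)) h3

/-- **`#E(L)[2] = 1` for `L/ℚ` finite with `3 ∤ [L : ℚ]`** when `W` has no rational `2`-torsion abscissa.
[cite: SilvermanAEC2009, §III.2 (ψ₂)] -/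
theorem natCard_torsionBy_two_baseChange_eq_one_of_forall_not_hasRationalTwoTorsionX [FiniteDimensional ℚ L]
    (ht : ∀ x : ℚ, ¬ HasRationalTwoTorsionX W x) (h3 : ¬ 3 ∣ Module.finrank ℚ L) :
    Nat.card ((W.baseChange L).toAffine.Point[(2 : ℤ)]) = 1 :=
  W.natCard_torsionBy_two_baseChange_eq_one_of_not_three_dvd_finrank two_ne_zero
    (fun x hx ↦ ht x ((W.hasRationalTwoTorsionX_iff_isRoot_twoTorsionPolynomial x).mpr hx)) h3

/-- **`#E(L)[2] = 1` for `L/ℚ` of `2`-power degree** when `W` has no rational `2`-torsion abscissa (`3 ∤ 2^n`).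
[cite: SilvermanAEC2009, §III.2 (ψ₂)] -/
theorem natCard_torsionBy_two_baseChange_eq_one_of_finrank_eq_two_pow [FiniteDimensional ℚ L]
    (ht : ∀ x : ℚ, ¬ HasRationalTwoTorsionX W x) {n : ℕ} (hL : Module.finrank ℚ L = 2 ^ n) :
    Nat.card ((W.baseChange L).toAffine.Point[(2 : ℤ)]) = 1 := by
  refine W.natCard_torsionBy_two_baseChange_eq_one_of_forall_not_hasRationalTwoTorsionX ht ?_
  rw [hL]
  intro h
  have h32 : (3 : ℕ) ∣ 2 := (Nat.Prime.dvd_of_dvd_pow Nat.prime_three h)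
  omega

/-- ★ **The `2`-descent over an extension of degree prime to `3` counts `Sel_{2^∞}[2]` exactly**: for `W/ℚ` elliptic
without rational `2`-torsion abscissa and a number field `L` with `3 ∤ [L : ℚ]`,
`#Sel^(2)(E_L/L) = #Sel_{2^∞}(E_L/L)[2]` (§1 with `E(L)[2] = 0` from §2).
[cite: SilvermanAEC2009, Thm. X.4.2 and §III.2] [cite: Greenberg1999LNM, §2 pp. 62–63] -/
theorem natCard_selmerGroup_two_baseChange_eq_of_forall_not_hasRationalTwoTorsionX [NumberField L] [W.IsElliptic]
    (ht : ∀ x : ℚ, ¬ HasRationalTwoTorsionX W x) (h3 : ¬ 3 ∣ Module.finrank ℚ L) :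
    Nat.card ((W.baseChange L).selmerGroup 2) = Nat.card (((W.baseChange L).selmerGroupPInfty 2)[(2 : ℤ)]) := by
  haveI : Fact (Nat.Prime 2) := ⟨Nat.prime_two⟩
  haveI : (W.baseChange L).IsElliptic := by infer_instance
  exact_mod_cast (W.baseChange L).natCard_selmerGroup_eq_natCard_torsionBy_selmerGroupPInfty_of_forall 2
    (by exact_mod_cast W.forall_two_smul_eq_zero_baseChange_of_forall_not_hasRationalTwoTorsionX ht h3)

end Rat

/-! ## §4 Over the base field itself (instance-generic in `DecidableEq`): `E(K)[2] = 0` and `#Sel^(2)(E/ℚ) = #Sel_{2^∞}(E/ℚ)[2]` -/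

section BaseField

variable {K : Type u} [Field K] {instDec : DecidableEq K} (W : WeierstrassCurve K)

/-- **A `K`-point of order dividing `2` is `O` or has `ψ₂ = 2y + a₁x + a₃ = 0` and abscissa a root of the `2`-division cubic**
(the base-field case of `aeval_twoTorsionPolynomial_eq_zero_of_two_smul_eq_zero`; stated for ANY `DecidableEq K` instance carried
by the group law on `E(K)`, so that it applies verbatim over `ℚ` with its computable equality).
[cite: SilvermanAEC2009, §III.2 (Group Law III.2.3 and ψ₂)] -/
theorem isRoot_twoTorsionPolynomial_of_two_smul_eq_zero {x y : K} (h : W.toAffine.Nonsingular x y)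
    (h2 : (2 : ℤ) • (Affine.Point.some x y h : W.toAffine.Point) = 0) :
    2 * y + W.a₁ * x + W.a₃ = 0 ∧ W.twoTorsionPolynomial.toPoly.IsRoot x := by
  have hA1 : W.toAffine.a₁ = W.a₁ := rfl
  have hA2 : W.toAffine.a₂ = W.a₂ := rfl
  have hA3 : W.toAffine.a₃ = W.a₃ := rfl
  have hA4 : W.toAffine.a₄ = W.a₄ := rfl
  have hA6 : W.toAffine.a₆ = W.a₆ := rfl
  have hneg : (Affine.Point.some x y h : W.toAffine.Point) = -Affine.Point.some x y h :=
    eq_neg_of_add_eq_zero_left (by rwa [two_zsmul] at h2)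
  rw [Affine.Point.neg_some, Affine.Point.some.injEq] at hneg
  have hy : y = -y - W.toAffine.a₁ * x - W.toAffine.a₃ := hneg.2
  rw [hA1, hA3] at hy
  have he : 2 * y + W.a₁ * x + W.a₃ = 0 := by linear_combination hy
  refine ⟨he, ?_⟩
  have heq := (Affine.equation_iff x y).mp h.1
  rw [hA1, hA2, hA3, hA4, hA6] at heq
  change W.twoTorsionPolynomial.toPoly.eval x = 0
  rw [W.eval_twoTorsionPolynomial_toPoly x]
  simp only [WeierstrassCurve.b₂, WeierstrassCurve.b₄, WeierstrassCurve.b₆]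
  linear_combination (2 * y + W.a₁ * x + W.a₃) * he - 4 * heq

/-- **No `K`-root of the `2`-division cubic ⟹ `E(K)[2] = 0`** (in the shape `2 • P = 0 → P = 0`, any `DecidableEq K` instance).
[cite: SilvermanAEC2009, §III.2 (ψ₂² = 4x³ + b₂x² + 2b₄x + b₆)] -/
theorem forall_two_smul_eq_zero_of_forall_not_isRoot (hK : ∀ x : K, ¬ W.twoTorsionPolynomial.toPoly.IsRoot x) :
    ∀ P : W.toAffine.Point, (2 : ℤ) • P = 0 → P = 0 := by
  rintro (_ | ⟨x, y, h⟩) hP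
  · rfl
  · exact absurd (W.isRoot_twoTorsionPolynomial_of_two_smul_eq_zero h hP).2 (hK x)

end BaseField

section RatBase

open Literature.NumberTheory.EllipticCurves.Greenberg1999

variable {instDec : DecidableEq ℚ} (W : WeierstrassCurve ℚ)

/-- **No rational `2`-torsion abscissa ⟹ `E(ℚ)[2] = 0`** in the shape `2 • P = 0 → P = 0` (any `DecidableEq ℚ` instance — the
tree states Mordell–Weil lemmas with the classical one, Mathlib computes with `Rat.instDecidableEq`).
[cite: SilvermanAEC2009, §III.2 (ψ₂)] -/
theorem forall_two_smul_eq_zero_of_forall_not_hasRationalTwoTorsionX (ht : ∀ x : ℚ, ¬ HasRationalTwoTorsionX W x) :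
    ∀ P : W.toAffine.Point, (2 : ℤ) • P = 0 → P = 0 :=
  W.forall_two_smul_eq_zero_of_forall_not_isRoot
    (fun x hx ↦ ht x ((W.hasRationalTwoTorsionX_iff_isRoot_twoTorsionPolynomial x).mpr hx))

omit instDec in
/-- ★ **`#Sel^(2)(E/ℚ) = #Sel_{2^∞}(E/ℚ)[2]` without rational `2`-torsion abscissa**: over `ℚ` itself the `2`-descent computes the
`2`-torsion of the `2^∞`-Selmer group exactly (§1 with `E(ℚ)[2] = 0`). [cite: SilvermanAEC2009, Thm. X.4.2 and §III.2]
[cite: Greenberg1999LNM, §2 pp. 62–63] -/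
theorem natCard_selmerGroup_two_eq_of_forall_not_hasRationalTwoTorsionX [W.IsElliptic]
    (ht : ∀ x : ℚ, ¬ HasRationalTwoTorsionX W x) :
    Nat.card (W.selmerGroup 2) = Nat.card ((↥(W.selmerGroupPInfty 2))[(2 : ℤ)]) := by
  have hg := W.forall_two_smul_eq_zero_of_forall_not_hasRationalTwoTorsionX (instDec := Classical.decEq ℚ) ht
  exact_mod_cast W.natCard_selmerGroup_eq_natCard_torsionBy_selmerGroupPInfty_of_forall 2 fun P hP ↦
    hg P (by simpa only [Nat.cast_ofNat] using hP)

omit instDec in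
/-- ★ **`#Sel^(2)(E/ℚ) = #Ш(E/ℚ)[2]` in rank `0` without rational `2`-torsion abscissa** (Silverman X.4.2 with `r = 0`,
`#E(ℚ)[2] = 1`). [cite: SilvermanAEC2009, Thm. X.4.2 and §III.2] -/
theorem natCard_selmerGroup_two_eq_natCard_sha_of_rank_zero [W.IsElliptic]
    (ht : ∀ x : ℚ, ¬ HasRationalTwoTorsionX W x) (hr : W.mordellWeilRank = 0) :
    Nat.card (W.selmerGroup 2) = Nat.card ((↥W.sha)[(2 : ℤ)]) := by
  haveI : Fact (Nat.Prime 2) := ⟨Nat.prime_two⟩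
  have h := W.natCard_selmerGroup_two_eq_of_forall_not_hasRationalTwoTorsionX ht
  have h2 := W.natCard_torsionBy_selmerGroupPInfty_eq 2
  rw [hr, pow_zero, one_mul] at h2
  rw [h]
  exact_mod_cast h2

end RatBase

end WeierstrassCurve

end
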